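import Summits.HubbardSuperconductivity.HubbardSuperconductivity.Theorems.BalabanIRBirBdGPhaseCoercivityTrigPoly
import HarnessLib

/-!
# Crux `BirBdGPhaseCoercivity` (stmt-HubbardSuperconductivity-2081, route `BalabanIR`), line
`bcs-dual-persistence` (reshaped, `V := K`) — stub `stub_imSquareSum` (S7, the parameter-free
trigonometric sum)

For the `d+id` gap function `Δ_k = 2Δ₁(cos p₀ - cos p₁) - 4iΔ₂ sin p₀ sin p₁` (`p = 2πk/L`) on `(ℤ/L)²`,
`L ≥ 5`, and every `q`: `Σ_k (Im(conj(Δ_k) Δ_{k+q}))² ≥ 4Δ₁²Δ₂² L² ε(q)`, `ε(q) = 4 - 2cos q₀ - 2cos q₁`.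

Proof. `Im(conj(Δ_k) Δ_{k+q}) = -4 (a_k b_{k+q} - b_k a_{k+q})` (`a = 2Δ₁(cos p₀ - cos p₁)`,
`b = Δ₂ sin p₀ sin p₁`) `= -4Δ₁Δ₂ Q`, where (pure trigonometry, with `p₀,p₁` the momenta of `k` and
`q₀,q₁` those of `q`)
`Q = sin(2p₀+q₀)(sin(p₁+q₁) - sin p₁) + sin q₀ (sin(p₁+q₁) + sin p₁)`
`  - sin(2p₁+q₁)(sin(p₀+q₀) - sin p₀) - sin q₁ (sin(p₀+q₀) + sin p₀)`.
The four pieces have pairwise `k`-orthogonal frequencies; all cross sums vanish and the squares give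
`Σ_k Q² = L²[(1 - cos q₀)/2 + (1 - cos q₁)/2 + sin²q₀ (1 + cos q₁) + sin²q₁ (1 + cos q₀)] ≥ L² ε(q)/4`,
using only the one-dimensional lattice sums `Σ_{j<L} cos(n·2πj/L + φ) = 0`, `Σ_{j<L} sin(n·2πj/L + φ) = 0`
for `n ∈ {1,2,3,4}` (`L ≥ 5`, primitivity of the standard additive character of `ℤ/L`).
Momenta of `k + q`: `cos/sin (p(k+q)) = cos/sin (p(k) + p(q))` (`ZMod.val_add` + periodicity).
No definition is introduced. [folklore]
-/

noncomputable section

set_option linter.dupNamespace false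

namespace Summit.HubbardSuperconductivity.HubbardSuperconductivity.Theorems.BirBdGPhaseCoercivity

open Finset Literature.Probability.LatticeModels
open Summit.HubbardSuperconductivity.HubbardSuperconductivity.Theorems.BirBdG
open scoped ComplexConjugate

/-! ### One-dimensional lattice sums over `ℤ/L` -/

/-- `Σ_{j : ℤ/L} exp(i (n θ_j + φ)) = 0` for `0 < n < L`, `θ_j = 2πj/L` (primitivity of the standard
additive character). [folklore] -/
private theorem sum_exp_natMul_eq_zero {L : ℕ} [NeZero L] (n : ℕ) (hn0 : n ≠ 0) (hnL : n < L)
    (φ : ℝ) :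
    ∑ j : ZMod L, Complex.exp (((n * (2 * Real.pi * (j.val : ℝ) / L) + φ : ℝ) : ℂ) * Complex.I) = 0 := by
  have hne : ((n : ℕ) : ZMod L) ≠ 0 := by
    rw [Ne, ZMod.natCast_eq_zero_iff]
    exact fun h => absurd (Nat.le_of_dvd (Nat.pos_of_ne_zero hn0) h) (not_le.2 hnL)
  have h := AddChar.sum_mulShift ((n : ℕ) : ZMod L) (ZMod.isPrimitive_stdAddChar L)
  rw [if_neg hne, Nat.cast_zero] at h
  have hj : ∀ j : ZMod L,
      Complex.exp (((n * (2 * Real.pi * (j.val : ℝ) / L) + φ : ℝ) : ℂ) * Complex.I) =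
        Complex.exp ((φ : ℂ) * Complex.I) * (ZMod.stdAddChar (j * (n : ZMod L)) : ℂ) := by
    intro j
    rw [stdAddChar_mul_eq_exp, ZMod.val_cast_of_lt hnL, ← Complex.exp_add]
    congr 1
    push_cast
    ring
  simp_rw [hj, ← Finset.mul_sum, h, mul_zero]

/-- `Σ_{j : ℤ/L} cos(n θ_j + φ) = 0` for `0 < n < L`. [folklore] -/
private theorem sum_cos_natMul_eq_zero {L : ℕ} [NeZero L] (n : ℕ) (hn0 : n ≠ 0) (hnL : n < L)
    (φ : ℝ) : ∑ j : ZMod L, Real.cos (n * (2 * Real.pi * (j.val : ℝ) / L) + φ) = 0 := by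
  have h := congrArg Complex.re (sum_exp_natMul_eq_zero n hn0 hnL φ)
  rw [Complex.re_sum, Complex.zero_re] at h
  simpa only [Complex.exp_ofReal_mul_I_re] using h

/-- `Σ_{j : ℤ/L} sin(n θ_j + φ) = 0` for `0 < n < L`. [folklore] -/
private theorem sum_sin_natMul_eq_zero {L : ℕ} [NeZero L] (n : ℕ) (hn0 : n ≠ 0) (hnL : n < L)
    (φ : ℝ) : ∑ j : ZMod L, Real.sin (n * (2 * Real.pi * (j.val : ℝ) / L) + φ) = 0 := by
  have h := congrArg Complex.im (sum_exp_natMul_eq_zero n hn0 hnL φ)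
  rw [Complex.im_sum, Complex.zero_im] at h
  simpa only [Complex.exp_ofReal_mul_I_im] using h

/-! ### Abstract one-dimensional evaluations from vanishing harmonics -/

/-- `Σ_j sin²(2θ_j + φ) = |ι|/2` if the fourth harmonics vanish. [folklore] -/
private theorem sum_sin_two_sq {ι : Type*} [Fintype ι] (θ : ι → ℝ) (φ : ℝ)
    (h4 : ∀ ψ, ∑ j, Real.cos (4 * θ j + ψ) = 0) :
    ∑ j, Real.sin (2 * θ j + φ) ^ 2 = Fintype.card ι / 2 := by
  have e : ∀ j, Real.sin (2 * θ j + φ) ^ 2 = 1 / 2 - Real.cos (4 * θ j + 2 * φ) / 2 := fun j => by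
    rw [Real.sin_sq, Real.cos_sq, show 2 * (2 * θ j + φ) = 4 * θ j + 2 * φ by ring]; ring
  simp_rw [e, Finset.sum_sub_distrib, ← Finset.sum_div, h4, Finset.sum_const, Finset.card_univ,
    nsmul_eq_mul]
  ring

/-- `Σ_j (sin(θ_j + φ) - sin θ_j)² = |ι| (1 - cos φ)` if the second harmonics vanish. [folklore] -/
private theorem sum_sin_sub_sq {ι : Type*} [Fintype ι] (θ : ι → ℝ) (φ : ℝ)
    (h2 : ∀ ψ, ∑ j, Real.cos (2 * θ j + ψ) = 0) :
    ∑ j, (Real.sin (θ j + φ) - Real.sin (θ j)) ^ 2 = Fintype.card ι * (1 - Real.cos φ) := by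
  have e : ∀ j, (Real.sin (θ j + φ) - Real.sin (θ j)) ^ 2 =
      (1 - Real.cos φ) - Real.cos (2 * θ j + 2 * φ) / 2 - Real.cos (2 * θ j + 0) / 2 +
        Real.cos (2 * θ j + φ) := fun j => by
    have e1 : Real.sin (θ j + φ) ^ 2 = 1 / 2 - Real.cos (2 * θ j + 2 * φ) / 2 := by
      rw [Real.sin_sq, Real.cos_sq, show 2 * (θ j + φ) = 2 * θ j + 2 * φ by ring]; ring
    have e2 : Real.sin (θ j) ^ 2 = 1 / 2 - Real.cos (2 * θ j + 0) / 2 := by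
      rw [Real.sin_sq, Real.cos_sq, add_zero]; ring
    have e3 := Real.two_mul_sin_mul_sin (θ j + φ) (θ j)
    rw [show θ j + φ - θ j = φ by ring, show θ j + φ + θ j = 2 * θ j + φ by ring] at e3
    linear_combination e1 + e2 - e3
  simp_rw [e, Finset.sum_add_distrib, Finset.sum_sub_distrib, ← Finset.sum_div, h2,
    Finset.sum_const, Finset.card_univ, nsmul_eq_mul]
  ring

/-- `Σ_j (sin(θ_j + φ) + sin θ_j)² = |ι| (1 + cos φ)` if the second harmonics vanish. [folklore] -/
private theorem sum_sin_add_sq {ι : Type*} [Fintype ι] (θ : ι → ℝ) (φ : ℝ)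
    (h2 : ∀ ψ, ∑ j, Real.cos (2 * θ j + ψ) = 0) :
    ∑ j, (Real.sin (θ j + φ) + Real.sin (θ j)) ^ 2 = Fintype.card ι * (1 + Real.cos φ) := by
  have e : ∀ j, (Real.sin (θ j + φ) + Real.sin (θ j)) ^ 2 =
      (1 + Real.cos φ) - Real.cos (2 * θ j + 2 * φ) / 2 - Real.cos (2 * θ j + 0) / 2 -
        Real.cos (2 * θ j + φ) := fun j => by
    have e1 : Real.sin (θ j + φ) ^ 2 = 1 / 2 - Real.cos (2 * θ j + 2 * φ) / 2 := by
      rw [Real.sin_sq, Real.cos_sq, show 2 * (θ j + φ) = 2 * θ j + 2 * φ by ring]; ring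
    have e2 : Real.sin (θ j) ^ 2 = 1 / 2 - Real.cos (2 * θ j + 0) / 2 := by
      rw [Real.sin_sq, Real.cos_sq, add_zero]; ring
    have e3 := Real.two_mul_sin_mul_sin (θ j + φ) (θ j)
    rw [show θ j + φ - θ j = φ by ring, show θ j + φ + θ j = 2 * θ j + φ by ring] at e3
    linear_combination e1 + e2 + e3
  simp_rw [e, Finset.sum_sub_distrib, ← Finset.sum_div, h2,
    Finset.sum_const, Finset.card_univ, nsmul_eq_mul]
  ring

/-- `Σ_j (sin(θ_j + φ) - sin θ_j) = 0` if the first harmonics vanish. [folklore] -/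
private theorem sum_sin_sub {ι : Type*} [Fintype ι] (θ : ι → ℝ) (φ : ℝ)
    (h1 : ∀ ψ, ∑ j, Real.sin (θ j + ψ) = 0) :
    ∑ j, (Real.sin (θ j + φ) - Real.sin (θ j)) = 0 := by
  have h0 := h1 0
  simp only [add_zero] at h0
  rw [Finset.sum_sub_distrib, h1, h0, sub_zero]

/-- `Σ_j (sin(θ_j + φ) + sin θ_j) = 0` if the first harmonics vanish. [folklore] -/
private theorem sum_sin_add {ι : Type*} [Fintype ι] (θ : ι → ℝ) (φ : ℝ)
    (h1 : ∀ ψ, ∑ j, Real.sin (θ j + ψ) = 0) :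
    ∑ j, (Real.sin (θ j + φ) + Real.sin (θ j)) = 0 := by
  have h0 := h1 0
  simp only [add_zero] at h0
  rw [Finset.sum_add_distrib, h1, h0, add_zero]

/-- `Σ_j sin(2θ_j + φ)(sin(θ_j + φ) - sin θ_j) = 0` if the first and third harmonics vanish. [folklore] -/
private theorem sum_sin_two_mul_sin_sub {ι : Type*} [Fintype ι] (θ : ι → ℝ) (φ : ℝ)
    (h1 : ∀ ψ, ∑ j, Real.cos (θ j + ψ) = 0) (h3 : ∀ ψ, ∑ j, Real.cos (3 * θ j + ψ) = 0) :
    ∑ j, Real.sin (2 * θ j + φ) * (Real.sin (θ j + φ) - Real.sin (θ j)) = 0 := by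
  have e : ∀ j, Real.sin (2 * θ j + φ) * (Real.sin (θ j + φ) - Real.sin (θ j)) =
      Real.cos (θ j + 0) / 2 - Real.cos (3 * θ j + 2 * φ) / 2 - Real.cos (θ j + φ) / 2 +
        Real.cos (3 * θ j + φ) / 2 := fun j => by
    have e4 := Real.two_mul_sin_mul_sin (2 * θ j + φ) (θ j + φ)
    rw [show 2 * θ j + φ - (θ j + φ) = θ j + 0 by ring,
      show 2 * θ j + φ + (θ j + φ) = 3 * θ j + 2 * φ by ring] at e4
    have e5 := Real.two_mul_sin_mul_sin (2 * θ j + φ) (θ j)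
    rw [show 2 * θ j + φ - θ j = θ j + φ by ring, show 2 * θ j + φ + θ j = 3 * θ j + φ by ring] at e5
    linear_combination (e4 - e5) / 2
  simp_rw [e, Finset.sum_add_distrib, Finset.sum_sub_distrib, ← Finset.sum_div, h1, h3]
  ring

/-- Separable sums over `ι²` factor: `Σ_k F(k₀) G(k₁) = (Σ F)(Σ G)`. [folklore] -/
private theorem sum_sep {ι : Type*} [Fintype ι] (F G : ι → ℝ) :
    ∑ k : Fin 2 → ι, F (k 0) * G (k 1) = (∑ a, F a) * (∑ b, G b) := by
  rw [Finset.sum_mul_sum, ← Finset.sum_product', Finset.univ_product_univ]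
  exact Fintype.sum_equiv (finTwoArrowEquiv ι) _ _ fun k => rfl

/-! ### The key trigonometric identity and the exact two-dimensional evaluation -/

/-- The four-piece decomposition of `2[(cos x - cos y) sin(x+a) sin(y+b) - sin x sin y (cos(x+a) - cos(y+b))]`.
[folklore] -/
private theorem trig_key (x y a b : ℝ) :
    2 * ((Real.cos x - Real.cos y) * (Real.sin (x + a) * Real.sin (y + b)) -
        Real.sin x * Real.sin y * (Real.cos (x + a) - Real.cos (y + b))) =
      Real.sin (2 * x + a) * (Real.sin (y + b) - Real.sin y) +
        Real.sin a * (Real.sin (y + b) + Real.sin y) -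
        Real.sin (2 * y + b) * (Real.sin (x + a) - Real.sin x) -
        Real.sin b * (Real.sin (x + a) + Real.sin x) := by
  simp only [Real.sin_add, Real.cos_add, Real.sin_two_mul, Real.cos_two_mul]
  linear_combination (2 * Real.sin a * Real.sin y) * Real.sin_sq_add_cos_sq x -
    (2 * Real.sin b * Real.sin x) * Real.sin_sq_add_cos_sq y

/-- **Exact evaluation of the lattice sum of `Q²`** (abstract form): if the harmonics `1, …, 4` of
`θ : ι → ℝ` vanish for every phase, then for all phases `a, b`,
`Σ_{k ∈ ι²} Q(θ_{k₀}, θ_{k₁}; a, b)² = |ι|² [(1 - cos b)/2 + (1 - cos a)/2 + sin²a (1 + cos b) + sin²b (1 + cos a)]`.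
[folklore] -/
theorem imSquareSum_sum_sq_eval {ι : Type*} [Fintype ι] (θ : ι → ℝ)
    (hc1 : ∀ ψ, ∑ j, Real.cos (θ j + ψ) = 0) (hs1 : ∀ ψ, ∑ j, Real.sin (θ j + ψ) = 0)
    (hc2 : ∀ ψ, ∑ j, Real.cos (2 * θ j + ψ) = 0) (hs2 : ∀ ψ, ∑ j, Real.sin (2 * θ j + ψ) = 0)
    (hc3 : ∀ ψ, ∑ j, Real.cos (3 * θ j + ψ) = 0) (hc4 : ∀ ψ, ∑ j, Real.cos (4 * θ j + ψ) = 0)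
    (a b : ℝ) :
    ∑ k : Fin 2 → ι,
        (Real.sin (2 * θ (k 0) + a) * (Real.sin (θ (k 1) + b) - Real.sin (θ (k 1))) +
          Real.sin a * (Real.sin (θ (k 1) + b) + Real.sin (θ (k 1))) -
          Real.sin (2 * θ (k 1) + b) * (Real.sin (θ (k 0) + a) - Real.sin (θ (k 0))) -
          Real.sin b * (Real.sin (θ (k 0) + a) + Real.sin (θ (k 0)))) ^ 2 =
      (Fintype.card ι : ℝ) ^ 2 * ((1 - Real.cos b) / 2 + (1 - Real.cos a) / 2 +
        Real.sin a ^ 2 * (1 + Real.cos b) + Real.sin b ^ 2 * (1 + Real.cos a)) := by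
  -- the four pieces, as functions of one coordinate
  set F0 : ι → ℝ := fun j => Real.sin (2 * θ j + a) with hF0
  set F1 : ι → ℝ := fun j => Real.sin (2 * θ j + b) with hF1
  set Gm0 : ι → ℝ := fun j => Real.sin (θ j + a) - Real.sin (θ j) with hGm0
  set Gm1 : ι → ℝ := fun j => Real.sin (θ j + b) - Real.sin (θ j) with hGm1
  set Gp0 : ι → ℝ := fun j => Real.sin (θ j + a) + Real.sin (θ j) with hGp0
  set Gp1 : ι → ℝ := fun j => Real.sin (θ j + b) + Real.sin (θ j) with hGp1
  -- one-dimensional sums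
  have sF0 : ∑ j, F0 j = 0 := hs2 a
  have sF1 : ∑ j, F1 j = 0 := hs2 b
  have sGm0 : ∑ j, Gm0 j = 0 := sum_sin_sub θ a hs1
  have sGm1 : ∑ j, Gm1 j = 0 := sum_sin_sub θ b hs1
  have sGp0 : ∑ j, Gp0 j = 0 := sum_sin_add θ a hs1
  have sGp1 : ∑ j, Gp1 j = 0 := sum_sin_add θ b hs1
  have sF0sq : ∑ j, F0 j ^ 2 = Fintype.card ι / 2 := sum_sin_two_sq θ a hc4
  have sF1sq : ∑ j, F1 j ^ 2 = Fintype.card ι / 2 := sum_sin_two_sq θ b hc4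
  have sGm0sq : ∑ j, Gm0 j ^ 2 = Fintype.card ι * (1 - Real.cos a) := sum_sin_sub_sq θ a hc2
  have sGm1sq : ∑ j, Gm1 j ^ 2 = Fintype.card ι * (1 - Real.cos b) := sum_sin_sub_sq θ b hc2
  have sGp0sq : ∑ j, Gp0 j ^ 2 = Fintype.card ι * (1 + Real.cos a) := sum_sin_add_sq θ a hc2
  have sGp1sq : ∑ j, Gp1 j ^ 2 = Fintype.card ι * (1 + Real.cos b) := sum_sin_add_sq θ b hc2
  have sFGm0 : ∑ j, F0 j * Gm0 j = 0 := sum_sin_two_mul_sin_sub θ a hc1 hc3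
  have sFGm1 : ∑ j, F1 j * Gm1 j = 0 := sum_sin_two_mul_sin_sub θ b hc1 hc3
  -- pointwise expansion of the square into ten separable pieces
  have key : ∀ k : Fin 2 → ι,
      (F0 (k 0) * Gm1 (k 1) + Real.sin a * Gp1 (k 1) - F1 (k 1) * Gm0 (k 0) -
          Real.sin b * Gp0 (k 0)) ^ 2 =
        F0 (k 0) ^ 2 * Gm1 (k 1) ^ 2 + Real.sin a ^ 2 * Gp1 (k 1) ^ 2 +
          Gm0 (k 0) ^ 2 * F1 (k 1) ^ 2 + Gp0 (k 0) ^ 2 * Real.sin b ^ 2 +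
          (2 * Real.sin a * F0 (k 0)) * (Gm1 (k 1) * Gp1 (k 1)) -
          (2 * (F0 (k 0) * Gm0 (k 0))) * (Gm1 (k 1) * F1 (k 1)) -
          (2 * Real.sin b * (F0 (k 0) * Gp0 (k 0))) * Gm1 (k 1) -
          (2 * Real.sin a * Gm0 (k 0)) * (Gp1 (k 1) * F1 (k 1)) -
          (2 * Real.sin a * Real.sin b * Gp0 (k 0)) * Gp1 (k 1) +
          (2 * Real.sin b * (Gm0 (k 0) * Gp0 (k 0))) * F1 (k 1) := fun k => by ring
  have hsum : ∀ k : Fin 2 → ι,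
      Real.sin (2 * θ (k 0) + a) * (Real.sin (θ (k 1) + b) - Real.sin (θ (k 1))) +
          Real.sin a * (Real.sin (θ (k 1) + b) + Real.sin (θ (k 1))) -
          Real.sin (2 * θ (k 1) + b) * (Real.sin (θ (k 0) + a) - Real.sin (θ (k 0))) -
          Real.sin b * (Real.sin (θ (k 0) + a) + Real.sin (θ (k 0))) =
        F0 (k 0) * Gm1 (k 1) + Real.sin a * Gp1 (k 1) - F1 (k 1) * Gm0 (k 0) -
          Real.sin b * Gp0 (k 0) := fun k => by
    simp only [hF0, hF1, hGm0, hGm1, hGp0, hGp1]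
  -- the ten two-dimensional sums
  have e1 : ∑ k : Fin 2 → ι, F0 (k 0) ^ 2 * Gm1 (k 1) ^ 2 =
      Fintype.card ι / 2 * (Fintype.card ι * (1 - Real.cos b)) := by
    rw [← sF0sq, ← sGm1sq]
    exact sum_sep (fun x => F0 x ^ 2) (fun x => Gm1 x ^ 2)
  have e2 : ∑ k : Fin 2 → ι, Real.sin a ^ 2 * Gp1 (k 1) ^ 2 =
      (∑ _x : ι, Real.sin a ^ 2) * (Fintype.card ι * (1 + Real.cos b)) := by
    rw [← sGp1sq]
    exact sum_sep (fun _ => Real.sin a ^ 2) (fun x => Gp1 x ^ 2)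
  have e3 : ∑ k : Fin 2 → ι, Gm0 (k 0) ^ 2 * F1 (k 1) ^ 2 =
      Fintype.card ι * (1 - Real.cos a) * (Fintype.card ι / 2) := by
    rw [← sGm0sq, ← sF1sq]
    exact sum_sep (fun x => Gm0 x ^ 2) (fun x => F1 x ^ 2)
  have e4 : ∑ k : Fin 2 → ι, Gp0 (k 0) ^ 2 * Real.sin b ^ 2 =
      Fintype.card ι * (1 + Real.cos a) * ∑ _x : ι, Real.sin b ^ 2 := by
    rw [← sGp0sq]
    exact sum_sep (fun x => Gp0 x ^ 2) (fun _ => Real.sin b ^ 2)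
  have e5 : ∑ k : Fin 2 → ι, (2 * Real.sin a * F0 (k 0)) * (Gm1 (k 1) * Gp1 (k 1)) = 0 := by
    have h : ∑ k : Fin 2 → ι, (2 * Real.sin a * F0 (k 0)) * (Gm1 (k 1) * Gp1 (k 1)) =
        (∑ x, 2 * Real.sin a * F0 x) * ∑ x, Gm1 x * Gp1 x :=
      sum_sep (fun x => 2 * Real.sin a * F0 x) (fun x => Gm1 x * Gp1 x)
    rw [h, ← Finset.mul_sum, sF0, mul_zero, zero_mul]
  have e6 : ∑ k : Fin 2 → ι, (2 * (F0 (k 0) * Gm0 (k 0))) * (Gm1 (k 1) * F1 (k 1)) = 0 := by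
    have h : ∑ k : Fin 2 → ι, (2 * (F0 (k 0) * Gm0 (k 0))) * (Gm1 (k 1) * F1 (k 1)) =
        (∑ x, 2 * (F0 x * Gm0 x)) * ∑ x, Gm1 x * F1 x :=
      sum_sep (fun x => 2 * (F0 x * Gm0 x)) (fun x => Gm1 x * F1 x)
    rw [h, ← Finset.mul_sum, sFGm0, mul_zero, zero_mul]
  have e7 : ∑ k : Fin 2 → ι, (2 * Real.sin b * (F0 (k 0) * Gp0 (k 0))) * Gm1 (k 1) = 0 := by
    have h : ∑ k : Fin 2 → ι, (2 * Real.sin b * (F0 (k 0) * Gp0 (k 0))) * Gm1 (k 1) =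
        (∑ x, 2 * Real.sin b * (F0 x * Gp0 x)) * ∑ x, Gm1 x :=
      sum_sep (fun x => 2 * Real.sin b * (F0 x * Gp0 x)) (fun x => Gm1 x)
    rw [h, sGm1, mul_zero]
  have e8 : ∑ k : Fin 2 → ι, (2 * Real.sin a * Gm0 (k 0)) * (Gp1 (k 1) * F1 (k 1)) = 0 := by
    have h : ∑ k : Fin 2 → ι, (2 * Real.sin a * Gm0 (k 0)) * (Gp1 (k 1) * F1 (k 1)) =
        (∑ x, 2 * Real.sin a * Gm0 x) * ∑ x, Gp1 x * F1 x :=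
      sum_sep (fun x => 2 * Real.sin a * Gm0 x) (fun x => Gp1 x * F1 x)
    rw [h, ← Finset.mul_sum, sGm0, mul_zero, zero_mul]
  have e9 : ∑ k : Fin 2 → ι, (2 * Real.sin a * Real.sin b * Gp0 (k 0)) * Gp1 (k 1) = 0 := by
    have h : ∑ k : Fin 2 → ι, (2 * Real.sin a * Real.sin b * Gp0 (k 0)) * Gp1 (k 1) =
        (∑ x, 2 * Real.sin a * Real.sin b * Gp0 x) * ∑ x, Gp1 x :=
      sum_sep (fun x => 2 * Real.sin a * Real.sin b * Gp0 x) (fun x => Gp1 x)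
    rw [h, sGp1, mul_zero]
  have e10 : ∑ k : Fin 2 → ι, (2 * Real.sin b * (Gm0 (k 0) * Gp0 (k 0))) * F1 (k 1) = 0 := by
    have h : ∑ k : Fin 2 → ι, (2 * Real.sin b * (Gm0 (k 0) * Gp0 (k 0))) * F1 (k 1) =
        (∑ x, 2 * Real.sin b * (Gm0 x * Gp0 x)) * ∑ x, F1 x :=
      sum_sep (fun x => 2 * Real.sin b * (Gm0 x * Gp0 x)) (fun x => F1 x)
    rw [h, sF1, mul_zero]
  simp_rw [hsum, key]
  simp only [Finset.sum_add_distrib, Finset.sum_sub_distrib]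
  rw [e1, e2, e3, e4, e5, e6, e7, e8, e9, e10]
  simp only [Finset.sum_const, Finset.card_univ, nsmul_eq_mul]
  ring

/-! ### Pointwise ingredients on the discrete torus -/

/-- Momenta add modulo `2π`: `cos/sin (p(k+q)ᵢ) = cos/sin (p(k)ᵢ + p(q)ᵢ)`. [folklore] -/
private theorem cos_sin_latticeMomentum_add {d L : ℕ} [NeZero L] (k q : TorusSite d L) (i : Fin d) :
    Real.cos (latticeMomentum L (k + q) i) = Real.cos (latticeMomentum L k i + latticeMomentum L q i) ∧
      Real.sin (latticeMomentum L (k + q) i) =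
        Real.sin (latticeMomentum L k i + latticeMomentum L q i) := by
  obtain ⟨m, hm⟩ : ∃ m : ℕ, latticeMomentum L (k + q) i =
      latticeMomentum L k i + latticeMomentum L q i - m * (2 * Real.pi) := by
    refine ⟨((k i).val + (q i).val) / L, ?_⟩
    have hL : (L : ℝ) ≠ 0 := Nat.cast_ne_zero.2 (NeZero.ne L)
    have hdiv := Nat.mod_add_div ((k i).val + (q i).val) L
    have hmod : ((((k i).val + (q i).val) % L : ℕ) : ℝ) =
        ((k i).val : ℝ) + (q i).val - L * ((((k i).val + (q i).val) / L : ℕ) : ℝ) := by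
      rw [eq_sub_iff_add_eq]
      exact_mod_cast hdiv
    simp only [latticeMomentum, Pi.add_apply, ZMod.val_add, hmod]
    field_simp
  rw [hm, Real.cos_sub_nat_mul_two_pi, Real.sin_sub_nat_mul_two_pi]
  exact ⟨rfl, rfl⟩

/-- `Im(conj(a - 4ib) (a' - 4ib')) = -4 (a b' - b a')` for real `a, b, a', b'`. [folklore] -/
private theorem im_conj_sub_mul (a b a' b' : ℝ) :
    (conj ((a : ℂ) - 4 * Complex.I * (b : ℂ)) * ((a' : ℂ) - 4 * Complex.I * (b' : ℂ))).im =
      -4 * (a * b' - b * a') := by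
  simp only [map_sub, map_mul, Complex.conj_ofReal, Complex.conj_I, map_ofNat]
  simp only [Complex.mul_im, Complex.mul_re, Complex.sub_re, Complex.sub_im, Complex.ofReal_re,
    Complex.ofReal_im, Complex.I_re, Complex.I_im, Complex.neg_re, Complex.neg_im,
    Complex.re_ofNat, Complex.im_ofNat]
  ring

/-- **The parameter-free trigonometric sum**: `Σ_k (Im(conj Δ_k · Δ_{k+q}))² ≥ 4Δ₁²Δ₂² L² ε(q)` for the
`d+id` gap function on `(ℤ/L)²`, `L ≥ 5`. [folklore] -/
theorem stub_imSquareSum {L : ℕ} [NeZero L] (hL : 5 ≤ L) (Δ₁ Δ₂ : ℝ) (Δ : TorusSite 2 L → ℂ)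
    (hΔ : ∀ k, Δ k = ((2 * Δ₁ * (Real.cos (latticeMomentum L k 0) - Real.cos (latticeMomentum L k 1)) : ℝ) : ℂ) -
        4 * Complex.I * ((Δ₂ * Real.sin (latticeMomentum L k 0) * Real.sin (latticeMomentum L k 1) : ℝ) : ℂ))
    (q : TorusSite 2 L) :
    4 * Δ₁ ^ 2 * Δ₂ ^ 2 * ((L ^ 2 : ℕ) : ℝ) *
        (4 - 2 * Real.cos (latticeMomentum L q 0) - 2 * Real.cos (latticeMomentum L q 1)) ≤
      ∑ k, ((starRingEnd ℂ) (Δ k) * Δ (k + q)).im ^ 2 := by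
  -- the one-dimensional angle function
  set θ : ZMod L → ℝ := fun j => 2 * Real.pi * (j.val : ℝ) / L
  have hmom : ∀ (k : TorusSite 2 L) (i : Fin 2), latticeMomentum L k i = θ (k i) := fun _ _ => rfl
  -- vanishing harmonics `n = 1, …, 4` (`L ≥ 5`)
  have hc1 : ∀ ψ, ∑ j, Real.cos (θ j + ψ) = 0 := fun ψ => by
    simpa only [Nat.cast_one, one_mul] using sum_cos_natMul_eq_zero (L := L) 1 one_ne_zero (by omega) ψ
  have hs1 : ∀ ψ, ∑ j, Real.sin (θ j + ψ) = 0 := fun ψ => by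
    simpa only [Nat.cast_one, one_mul] using sum_sin_natMul_eq_zero (L := L) 1 one_ne_zero (by omega) ψ
  have hc2 : ∀ ψ, ∑ j, Real.cos (2 * θ j + ψ) = 0 := fun ψ => by
    simpa only [Nat.cast_ofNat] using sum_cos_natMul_eq_zero (L := L) 2 two_ne_zero (by omega) ψ
  have hs2 : ∀ ψ, ∑ j, Real.sin (2 * θ j + ψ) = 0 := fun ψ => by
    simpa only [Nat.cast_ofNat] using sum_sin_natMul_eq_zero (L := L) 2 two_ne_zero (by omega) ψ
  have hc3 : ∀ ψ, ∑ j, Real.cos (3 * θ j + ψ) = 0 := fun ψ => by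
    simpa only [Nat.cast_ofNat] using sum_cos_natMul_eq_zero (L := L) 3 (by norm_num) (by omega) ψ
  have hc4 : ∀ ψ, ∑ j, Real.cos (4 * θ j + ψ) = 0 := fun ψ => by
    simpa only [Nat.cast_ofNat] using sum_cos_natMul_eq_zero (L := L) 4 (by norm_num) (by omega) ψ
  -- the imaginary part, pointwise
  have him : ∀ k : TorusSite 2 L, ((starRingEnd ℂ) (Δ k) * Δ (k + q)).im =
      -4 * Δ₁ * Δ₂ *
        (Real.sin (2 * θ (k 0) + θ (q 0)) * (Real.sin (θ (k 1) + θ (q 1)) - Real.sin (θ (k 1))) +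
          Real.sin (θ (q 0)) * (Real.sin (θ (k 1) + θ (q 1)) + Real.sin (θ (k 1))) -
          Real.sin (2 * θ (k 1) + θ (q 1)) * (Real.sin (θ (k 0) + θ (q 0)) - Real.sin (θ (k 0))) -
          Real.sin (θ (q 1)) * (Real.sin (θ (k 0) + θ (q 0)) + Real.sin (θ (k 0)))) := by
    intro k
    rw [hΔ k, hΔ (k + q), im_conj_sub_mul, (cos_sin_latticeMomentum_add k q 0).1,
      (cos_sin_latticeMomentum_add k q 0).2, (cos_sin_latticeMomentum_add k q 1).1,
      (cos_sin_latticeMomentum_add k q 1).2]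
    simp only [hmom]
    linear_combination (-4 * Δ₁ * Δ₂) * trig_key (θ (k 0)) (θ (k 1)) (θ (q 0)) (θ (q 1))
  have hsq : ∀ k : TorusSite 2 L, ((starRingEnd ℂ) (Δ k) * Δ (k + q)).im ^ 2 =
      16 * Δ₁ ^ 2 * Δ₂ ^ 2 *
        (Real.sin (2 * θ (k 0) + θ (q 0)) * (Real.sin (θ (k 1) + θ (q 1)) - Real.sin (θ (k 1))) +
          Real.sin (θ (q 0)) * (Real.sin (θ (k 1) + θ (q 1)) + Real.sin (θ (k 1))) -
          Real.sin (2 * θ (k 1) + θ (q 1)) * (Real.sin (θ (k 0) + θ (q 0)) - Real.sin (θ (k 0))) -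
          Real.sin (θ (q 1)) * (Real.sin (θ (k 0) + θ (q 0)) + Real.sin (θ (k 0)))) ^ 2 := by
    intro k; rw [him k]; ring
  simp only [hsq, ← Finset.mul_sum]
  rw [imSquareSum_sum_sq_eval θ hc1 hs1 hc2 hs2 hc3 hc4 (θ (q 0)) (θ (q 1)), ZMod.card L]
  simp only [hmom]
  push_cast
  have hcos0 := Real.neg_one_le_cos (θ (q 0))
  have hcos1 := Real.neg_one_le_cos (θ (q 1))
  have hextra : 0 ≤ Real.sin (θ (q 0)) ^ 2 * (1 + Real.cos (θ (q 1))) +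
      Real.sin (θ (q 1)) ^ 2 * (1 + Real.cos (θ (q 0))) :=
    add_nonneg (mul_nonneg (sq_nonneg _) (by linarith)) (mul_nonneg (sq_nonneg _) (by linarith))
  have hpre : 0 ≤ 16 * Δ₁ ^ 2 * Δ₂ ^ 2 * (L : ℝ) ^ 2 := by positivity
  nlinarith [mul_nonneg hpre hextra]

end Summit.HubbardSuperconductivity.HubbardSuperconductivity.Theorems.BirBdGPhaseCoercivity

end
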